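import Mathlib
import Summits.Ventures.PercRepro2.UnionPASepDefs

/-!
# The union event for separated roots — the fibre inequalities and the `W`-level facts
(blind cell PercRepro2, mine-1 g33; proofs/MINE1-TFGEN.md §7, Theorem (AQ); part 2/3)

In the fibre over `C_s = W` the cluster of `t` is the plain cluster (separation): Harris gives
`H₀(FG) ≥ H₀(F) H₀(G)` and `H₁(F) ≥ P(t↮Y) H₀(F)`, and BHK 1.3 for the `t`-cluster with avoided
set `Y` (`bhk_induced`, decreasing pair via `M - F`) gives `H₁(F) H₁(G) ≤ P(t↮Y) H₁(FG)`. The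
functional `F̃(W) = P(t↮Y) a(W) H₀(F)(W) + (1 - a(W)) H₁(F)(W)` is an increasing nonnegative cluster
functional of `C_s` (the crossing of `{W ∩ X = ∅}` uses `H₁ ≥ P(t↮Y) H₀`). On the `W`-level the
plain cluster law of `s` satisfies Harris, BHK 1.3 with avoided set `X`, and the negative
correlation of a monotone functional with the lower set `{s ↮ X}`; the mixture inequality
`mix_ineq` (pure algebra, certified by `P(A)·Br = P(A)²·Cov + Bq + δδ'`) combines them.
-/

namespace Summit.Ventures.PercRepro2

namespace UnionSep

variable {V : Type*} {E : Type*} [Fintype E] [DecidableEq E] [Fintype V] [DecidableEq V]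
  {R : Type*} [CommRing R] [LinearOrder R] [IsStrictOrderedRing R]

/-! ## The fibre inequalities (functions of the `t`-cluster) -/

section Fibre

omit [Fintype E] [DecidableEq E] [Fintype V] [DecidableEq V] in
/-- `aInd Y (C_t ·)` is the indicator of the lower set `{t ↮ Y}`, so `-aInd Y (C_t ·)` is monotone. -/
lemma monotone_neg_aInd_cluster (ends : E → Sym2 V) (t : V) (Y : Finset V) : Monotone (fun ω : Config E => (-1 : R) * aInd Y (cluster ends ω t)) := by
  intro ω ω' h
  simp only
  have := aInd_antitone (R := R) Y (cluster_mono (ends := ends) h t)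
  linarith

omit [Fintype V] [DecidableEq V] [LinearOrder R] [IsStrictOrderedRing R] in
/-- `E[aInd Y (C_t)] = P(t ↮ Y)`. -/
lemma expect_aInd_cluster (p : E → R) (ends : E → Sym2 V) (t : V) (Y : Finset V) :
    expect p (fun ω => aInd Y (cluster ends ω t)) = prob p (avoidAll ends t Y) := by
  have e : (fun ω => aInd Y (cluster ends ω t)) = (avoidAll ends t Y).indicator (1 : Config E → R) := by
    funext ω
    exact (indicator_avoidAll_eq_aInd ends t Y ω).symm
  rw [prob_eq_expect_indicator, e]

omit [Fintype V] [DecidableEq V] in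
/-- Harris in the fibre: `H₀(FG) ≥ H₀(F) H₀(G)` for `F(W,·), G(W,·)` decreasing in the cluster. -/
lemma H0_mul_le (p : E → R) (hp : IsProbVec p) (ends : E → Sym2 V) (t : V) {F G : Set V → Set V → R}
    (hF : ∀ ⦃W W' C C' : Set V⦄, W ⊆ W' → C' ⊆ C → F W C ≤ F W' C')
    (hG : ∀ ⦃W W' C C' : Set V⦄, W ⊆ W' → C' ⊆ C → G W C ≤ G W' C') (W : Set V) :
    H0 p ends t F W * H0 p ends t G W ≤ H0 p ends t (fun W C => F W C * G W C) W := by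
  have hf : Monotone (fun ω => (-1 : R) * F W (cluster ends ω t)) := by
    intro ω ω' h
    have := hF (subset_refl W) (cluster_mono (ends := ends) h t)
    simp only
    linarith
  have hg : Monotone (fun ω => (-1 : R) * G W (cluster ends ω t)) := by
    intro ω ω' h
    have := hG (subset_refl W) (cluster_mono (ends := ends) h t)
    simp only
    linarith
  have key := expect_mul_expect_le_expect_mul hp hf hg
  rw [expect_const_mul, expect_const_mul] at key
  have e : ((fun ω => (-1 : R) * F W (cluster ends ω t)) *
      fun ω => (-1 : R) * G W (cluster ends ω t)) =
      fun ω => F W (cluster ends ω t) * G W (cluster ends ω t) := by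
    funext ω
    simp only [Pi.mul_apply]
    ring
  rw [e] at key
  unfold H0
  linarith [key]

omit [Fintype V] [DecidableEq V] in
/-- Harris in the fibre, with the avoidance indicator: `H₁(F) ≥ P(t ↮ Y) H₀(F)`. -/
lemma prob_mul_H0_le_H1 (p : E → R) (hp : IsProbVec p) (ends : E → Sym2 V) (t : V) (Y : Finset V) {F : Set V → Set V → R}
    (hF : ∀ ⦃W W' C C' : Set V⦄, W ⊆ W' → C' ⊆ C → F W C ≤ F W' C') (W : Set V) :
    prob p (avoidAll ends t Y) * H0 p ends t F W ≤ H1 p ends t Y F W := by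
  have hf : Monotone (fun ω => (-1 : R) * F W (cluster ends ω t)) := by
    intro ω ω' h
    have := hF (subset_refl W) (cluster_mono (ends := ends) h t)
    simp only
    linarith
  have key := expect_mul_expect_le_expect_mul hp hf (monotone_neg_aInd_cluster (R := R) ends t Y)
  rw [expect_const_mul, expect_const_mul, expect_aInd_cluster p ends t Y] at key
  have e : ((fun ω => (-1 : R) * F W (cluster ends ω t)) *
      fun ω => (-1 : R) * aInd Y (cluster ends ω t)) =
      fun ω => F W (cluster ends ω t) * aInd Y (cluster ends ω t) := by
    funext ω
    simp only [Pi.mul_apply]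
    ring
  rw [e] at key
  unfold H0 H1
  linarith [key]

omit [Fintype V] [DecidableEq V] [LinearOrder R] [IsStrictOrderedRing R] in
/-- `E[(M - F(W, C_t)) 1_{t↮Y}] = M P(t↮Y) - H₁(F)(W)`. -/
lemma expect_sub_mul_aInd (p : E → R) (ends : E → Sym2 V) (t : V) (Y : Finset V) (M : R) {F : Set V → Set V → R} (W : Set V) :
    expect p (fun ω => (M - F W (cluster ends ω t)) * aInd Y (cluster ends ω t)) =
      M * prob p (avoidAll ends t Y) - H1 p ends t Y F W := by
  have e : (fun ω => (M - F W (cluster ends ω t)) * aInd Y (cluster ends ω t)) =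
      (fun ω => M * aInd Y (cluster ends ω t)) -
        fun ω => F W (cluster ends ω t) * aInd Y (cluster ends ω t) := by
    funext ω
    simp only [Pi.sub_apply]
    ring
  rw [e, expect_sub, expect_const_mul, expect_aInd_cluster p ends t Y]
  rfl

omit [Fintype V] [DecidableEq V] [LinearOrder R] [IsStrictOrderedRing R] in
/-- `E[(M - F)(M - G) 1_{t↮Y}]` expanded through `H₁`. -/
lemma expect_sub_mul_sub_mul_aInd (p : E → R) (ends : E → Sym2 V) (t : V) (Y : Finset V) (M : R) {F G : Set V → Set V → R} (W : Set V) :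
    expect p (fun ω => (M - F W (cluster ends ω t)) * (M - G W (cluster ends ω t)) *
        aInd Y (cluster ends ω t)) =
      M * M * prob p (avoidAll ends t Y) - M * H1 p ends t Y G W - M * H1 p ends t Y F W +
        H1 p ends t Y (fun W C => F W C * G W C) W := by
  have e : (fun ω => (M - F W (cluster ends ω t)) * (M - G W (cluster ends ω t)) *
      aInd Y (cluster ends ω t)) =
      ((fun ω => M * M * aInd Y (cluster ends ω t)) -
        fun ω => M * (G W (cluster ends ω t) * aInd Y (cluster ends ω t))) -
        (fun ω => M * (F W (cluster ends ω t) * aInd Y (cluster ends ω t))) +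
        fun ω => F W (cluster ends ω t) * G W (cluster ends ω t) * aInd Y (cluster ends ω t) := by
    funext ω
    simp only [Pi.add_apply, Pi.sub_apply]
    ring
  rw [e, expect_add, expect_sub, expect_sub, expect_const_mul, expect_const_mul, expect_const_mul,
    expect_aInd_cluster p ends t Y]
  rfl

/-- **BHK 1.3 in the fibre** (the `t`-cluster avoiding `Y`, decreasing pair via `M - F`):
`H₁(F) H₁(G) ≤ P(t ↮ Y) H₁(FG)`. -/
lemma H1_mul_le (p : E → R) (hp : IsProbVec p) (ends : E → Sym2 V) (t : V) (Y : Finset V) {F G : Set V → Set V → R}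
    (hF : ∀ ⦃W W' C C' : Set V⦄, W ⊆ W' → C' ⊆ C → F W C ≤ F W' C')
    (hG : ∀ ⦃W W' C C' : Set V⦄, W ⊆ W' → C' ⊆ C → G W C ≤ G W' C') {M : R}
    (hFM : ∀ W C, F W C ≤ M) (hGM : ∀ W C, G W C ≤ M) (W : Set V) :
    H1 p ends t Y F W * H1 p ends t Y G W ≤
      prob p (avoidAll ends t Y) * H1 p ends t Y (fun W C => F W C * G W C) W := by
  classical
  have hF₁ : Monotone (fun C => M - F W C) := fun C C' h => by
    have := hF (subset_refl W) h
    simp only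
    linarith
  have hF₂ : Monotone (fun C => M - G W C) := fun C C' h => by
    have := hG (subset_refl W) h
    simp only
    linarith
  have hF₁0 : ∀ C, 0 ≤ M - F W C := fun C => by linarith [hFM W C]
  have hF₂0 : ∀ C, 0 ≤ M - G W C := fun C => by linarith [hGM W C]
  have key := bhk_induced p hp ends t hF₁ hF₂ hF₁0 hF₂0 Finset.univ Y Y (Finset.subset_univ _)
    (Finset.subset_univ _)
  simp only [Finset.inter_self, Finset.union_self, REvent_univ] at key
  have e : ∀ F' : Set V → R, clusterObs ends Finset.univ t F' * (avoidAll ends t Y).indicator 1 =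
      fun ω => F' (cluster ends ω t) * aInd Y (cluster ends ω t) := by
    intro F'
    funext ω
    simp only [Pi.mul_apply, clusterObs_apply, clusterIn_univ, indicator_avoidAll_eq_aInd]
  rw [e, e, e] at key
  simp only [Pi.mul_apply] at key
  rw [expect_sub_mul_aInd p ends t Y, expect_sub_mul_aInd p ends t Y, expect_sub_mul_sub_mul_aInd p ends t Y] at key
  set β := prob p (avoidAll ends t Y)
  set hF1 := H1 p ends t Y F W
  set hG1 := H1 p ends t Y G W
  set hFG1 := H1 p ends t Y (fun W C => F W C * G W C) W
  have iden : (M * M * β - M * hG1 - M * hF1 + hFG1) * β - (M * β - hF1) * (M * β - hG1) =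
      β * hFG1 - hF1 * hG1 := by ring
  linarith [key, iden]

omit [Fintype V] [DecidableEq V] in
/-- `H₀(F) ≥ 0` for `F ≥ 0`. -/
lemma H0_nonneg (p : E → R) (hp : IsProbVec p) (ends : E → Sym2 V) (t : V) {F : Set V → Set V → R} (hF0 : ∀ W C, 0 ≤ F W C) (W : Set V) :
    0 ≤ H0 p ends t F W :=
  expect_nonneg hp fun _ => hF0 _ _

omit [Fintype V] [DecidableEq V] in
/-- `H₁(F) ≥ 0` for `F ≥ 0`. -/
lemma H1_nonneg (p : E → R) (hp : IsProbVec p) (ends : E → Sym2 V) (t : V) (Y : Finset V) {F : Set V → Set V → R} (hF0 : ∀ W C, 0 ≤ F W C) (W : Set V) :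
    0 ≤ H1 p ends t Y F W :=
  expect_nonneg hp fun _ => mul_nonneg (hF0 _ _) (aInd_nonneg _ _)

omit [Fintype V] [DecidableEq V] in
/-- `H₀(F)` is increasing in `W`. -/
lemma H0_mono (p : E → R) (hp : IsProbVec p) (ends : E → Sym2 V) (t : V) {F : Set V → Set V → R}
    (hF : ∀ ⦃W W' C C' : Set V⦄, W ⊆ W' → C' ⊆ C → F W C ≤ F W' C') :
    Monotone (H0 p ends t F) :=
  fun _ _ h => expect_mono hp fun _ => hF h (subset_refl _)

omit [Fintype V] [DecidableEq V] in
/-- `H₁(F)` is increasing in `W`. -/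
lemma H1_mono (p : E → R) (hp : IsProbVec p) (ends : E → Sym2 V) (t : V) (Y : Finset V) {F : Set V → Set V → R}
    (hF : ∀ ⦃W W' C C' : Set V⦄, W ⊆ W' → C' ⊆ C → F W C ≤ F W' C') :
    Monotone (H1 p ends t Y F) :=
  fun _ _ h => expect_mono hp fun _ =>
    mul_le_mul_of_nonneg_right (hF h (subset_refl _)) (aInd_nonneg _ _)

omit [Fintype V] [DecidableEq V] in
/-- If `P(t ↮ Y) = 0` then `H₁ ≡ 0` (for `0 ≤ F ≤ M`). -/
lemma H1_eq_zero_of_prob_eq_zero (p : E → R) (hp : IsProbVec p) (ends : E → Sym2 V) (t : V) (Y : Finset V) {F : Set V → Set V → R} (hF0 : ∀ W C, 0 ≤ F W C) {M : R}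
    (hFM : ∀ W C, F W C ≤ M) (hβ : prob p (avoidAll ends t Y) = 0) (W : Set V) :
    H1 p ends t Y F W = 0 := by
  apply le_antisymm _ (H1_nonneg p hp ends t Y hF0 W)
  have h1 : H1 p ends t Y F W ≤ expect p (fun ω => M * aInd Y (cluster ends ω t)) :=
    expect_mono hp fun ω => mul_le_mul_of_nonneg_right (hFM _ _) (aInd_nonneg _ _)
  rw [expect_const_mul, expect_aInd_cluster p ends t Y, hβ, mul_zero] at h1
  exact h1

end Fibre

/-! ## The `W`-level: the increasing functional `F̃` and three facts about the cluster law of `s` -/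

section Marginal

/-- The increasing cluster functional `F̃(W) = P(t↮Y) a(W) H₀(F)(W) + (1 - a(W)) H₁(F)(W)`
(`= P(t↮Y) · E[F | C_s = W, U]`). -/
noncomputable def Ft (p : E → R) (ends : E → Sym2 V) (t : V) (X Y : Finset V)
    (F : Set V → Set V → R) (W : Set V) : R :=
  prob p (avoidAll ends t Y) * aInd X W * H0 p ends t F W + (1 - aInd X W) * H1 p ends t Y F W

omit [Fintype V] [DecidableEq V] in
/-- `F̃ ≥ 0` for `F ≥ 0`. -/
lemma Ft_nonneg (p : E → R) (hp : IsProbVec p) (ends : E → Sym2 V) (t : V) (X Y : Finset V)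
    {F : Set V → Set V → R} (hF0 : ∀ W C, 0 ≤ F W C) (W : Set V) :
    0 ≤ Ft p ends t X Y F W := by
  unfold Ft
  have h1 := aInd_le_one (R := R) X W
  have h2 := aInd_nonneg (R := R) X W
  have h3 := H0_nonneg p hp ends t hF0 W
  have h4 := H1_nonneg p hp ends t Y hF0 W
  have h5 := prob_nonneg hp (avoidAll ends t Y)
  have : 0 ≤ (1 - aInd X W) * H1 p ends t Y F W := mul_nonneg (by linarith) h4
  have : 0 ≤ prob p (avoidAll ends t Y) * aInd X W * H0 p ends t F W :=
    mul_nonneg (mul_nonneg h5 h2) h3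
  linarith

omit [Fintype V] [DecidableEq V] in
/-- `F̃` is increasing in `W` (the crossing of `{W ∩ X = ∅}` uses `H₁ ≥ P(t↮Y) H₀`). -/
lemma Ft_mono (p : E → R) (hp : IsProbVec p) (ends : E → Sym2 V) (t : V) (X Y : Finset V)
    {F : Set V → Set V → R}
    (hF : ∀ ⦃W W' C C' : Set V⦄, W ⊆ W' → C' ⊆ C → F W C ≤ F W' C') :
    Monotone (Ft p ends t X Y F) := by
  intro W W' h
  have hβ := prob_nonneg hp (avoidAll ends t Y)
  have h0 := H0_mono p hp ends t hF h
  have h1 := H1_mono p hp ends t Y hF h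
  unfold Ft
  by_cases hW' : ∀ x ∈ X, x ∉ W'
  · have hW : ∀ x ∈ X, x ∉ W := fun x hx hxW => hW' x hx (h hxW)
    rw [aInd_eq_one hW, aInd_eq_one hW']
    have := mul_le_mul_of_nonneg_left h0 hβ
    linarith
  · rw [aInd_eq_zero hW']
    by_cases hW : ∀ x ∈ X, x ∉ W
    · rw [aInd_eq_one hW]
      have h2 := prob_mul_H0_le_H1 p hp ends t Y hF W'
      have := mul_le_mul_of_nonneg_left h0 hβ
      linarith
    · rw [aInd_eq_zero hW]
      linarith

omit [Fintype V] [DecidableEq V] in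
/-- Harris for two monotone cluster functionals of `s`. -/
lemma harris_cluster (p : E → R) (hp : IsProbVec p) (ends : E → Sym2 V) (s : V)
    {Φ Ψ : Set V → R} (hΦ : Monotone Φ) (hΨ : Monotone Ψ) :
    expect p (fun ω => Φ (cluster ends ω s)) * expect p (fun ω => Ψ (cluster ends ω s)) ≤
      expect p (fun ω => Φ (cluster ends ω s) * Ψ (cluster ends ω s)) := by
  have hf : Monotone (fun ω : Config E => Φ (cluster ends ω s)) :=
    fun _ _ h => hΦ (cluster_mono h s)
  have hg : Monotone (fun ω : Config E => Ψ (cluster ends ω s)) :=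
    fun _ _ h => hΨ (cluster_mono h s)
  exact expect_mul_expect_le_expect_mul hp hf hg

/-- BHK 1.3 (`bhk_induced`, `X = Y`) for two monotone nonnegative cluster functionals of `s`, with
the avoidance indicator written as `aInd X (C_s)`. -/
lemma bhk_cluster_avoid (p : E → R) (hp : IsProbVec p) (ends : E → Sym2 V) (s : V) (X : Finset V)
    {Φ Ψ : Set V → R} (hΦ : Monotone Φ) (hΨ : Monotone Ψ) (hΦ0 : ∀ W, 0 ≤ Φ W)
    (hΨ0 : ∀ W, 0 ≤ Ψ W) :
    expect p (fun ω => Φ (cluster ends ω s) * aInd X (cluster ends ω s)) *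
        expect p (fun ω => Ψ (cluster ends ω s) * aInd X (cluster ends ω s)) ≤
      expect p (fun ω => Φ (cluster ends ω s) * Ψ (cluster ends ω s) * aInd X (cluster ends ω s)) *
        prob p (avoidAll ends s X) := by
  classical
  have key := bhk_induced p hp ends s hΦ hΨ hΦ0 hΨ0 Finset.univ X X (Finset.subset_univ _)
    (Finset.subset_univ _)
  simp only [Finset.inter_self, Finset.union_self, REvent_univ] at key
  have e : ∀ F' : Set V → R, clusterObs ends Finset.univ s F' * (avoidAll ends s X).indicator 1 =
      fun ω => F' (cluster ends ω s) * aInd X (cluster ends ω s) := by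
    intro F'
    funext ω
    simp only [Pi.mul_apply, clusterObs_apply, clusterIn_univ, indicator_avoidAll_eq_aInd]
  rw [e, e, e] at key
  simp only [Pi.mul_apply] at key
  exact key

omit [Fintype V] [DecidableEq V] in
/-- A monotone cluster functional is negatively correlated with the lower set `{s ↮ X}`. -/
lemma expect_mul_aInd_le (p : E → R) (hp : IsProbVec p) (ends : E → Sym2 V) (s : V) (X : Finset V)
    {Φ : Set V → R} (hΦ : Monotone Φ) :
    expect p (fun ω => Φ (cluster ends ω s) * aInd X (cluster ends ω s)) ≤
      expect p (fun ω => Φ (cluster ends ω s)) * prob p (avoidAll ends s X) := by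
  have hf : Monotone (fun ω : Config E => Φ (cluster ends ω s)) :=
    fun _ _ h => hΦ (cluster_mono h s)
  have key := expect_mul_indicator_le_of_isLowerSet hp hf (isLowerSet_avoidAll ends s X)
  have e : ((fun ω : Config E => Φ (cluster ends ω s)) * (avoidAll ends s X).indicator 1) =
      fun ω => Φ (cluster ends ω s) * aInd X (cluster ends ω s) := by
    funext ω
    simp only [Pi.mul_apply, indicator_avoidAll_eq_aInd]
  rw [e] at key
  exact key

omit [Fintype E] [DecidableEq E] [Fintype V] [DecidableEq V] in
/-- The mixture inequality, multiplied out: positive association of the two-point mixture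
`β μ + (1-β) P(A) μ_A` from Harris (`hC`), BHK on `A` (`hB`) and the negative correlation with
`A` (`hD`, `hD'`, `hD''`), certified by `P(A)·Br = P(A)²·Cov + Bq + δδ'`. -/
lemma mix_ineq {β γ PA eF eG eFG aF aG aFG : R} (hβ : 0 ≤ β) (hγ : 0 ≤ γ) (hPA : 0 ≤ PA)
    (hC : eF * eG ≤ eFG) (hB : aF * aG ≤ aFG * PA) (hD : aF ≤ eF * PA) (hD' : aG ≤ eG * PA)
    (hD'' : aFG ≤ eFG * PA) (h0F : 0 ≤ aF) (h0G : 0 ≤ aG) (h0FG : 0 ≤ aFG) :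
    (β * eF + γ * aF) * (β * eG + γ * aG) ≤ (β * eFG + γ * aFG) * (β + γ * PA) := by
  rcases hPA.eq_or_lt with h0 | hpos
  · rw [← h0] at hD hD' hD'' ⊢
    have e1 : aF = 0 := le_antisymm (by linarith) h0F
    have e2 : aG = 0 := le_antisymm (by linarith) h0G
    have e3 : aFG = 0 := le_antisymm (by linarith) h0FG
    rw [e1, e2, e3]
    have : β * β * (eF * eG) ≤ β * β * eFG := mul_le_mul_of_nonneg_left hC (mul_nonneg hβ hβ)
    nlinarith
  · have key : PA * ((β * eFG + γ * aFG) * (β + γ * PA) - (β * eF + γ * aF) * (β * eG + γ * aG)) =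
        PA * β ^ 2 * (eFG - eF * eG) + PA * γ ^ 2 * (aFG * PA - aF * aG) +
          β * γ * (PA ^ 2 * (eFG - eF * eG) + (aFG * PA - aF * aG) +
            (eF * PA - aF) * (eG * PA - aG)) := by ring
    have h1 : 0 ≤ PA * β ^ 2 * (eFG - eF * eG) :=
      mul_nonneg (mul_nonneg hPA (sq_nonneg β)) (by linarith)
    have h2 : 0 ≤ PA * γ ^ 2 * (aFG * PA - aF * aG) :=
      mul_nonneg (mul_nonneg hPA (sq_nonneg γ)) (by linarith)
    have h3 : 0 ≤ β * γ * (PA ^ 2 * (eFG - eF * eG) + (aFG * PA - aF * aG) +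
        (eF * PA - aF) * (eG * PA - aG)) := by
      apply mul_nonneg (mul_nonneg hβ hγ)
      have := mul_nonneg (sq_nonneg PA) (show 0 ≤ eFG - eF * eG by linarith)
      have := mul_nonneg (show 0 ≤ eF * PA - aF by linarith) (show 0 ≤ eG * PA - aG by linarith)
      linarith
    have hprod : 0 ≤ PA * ((β * eFG + γ * aFG) * (β + γ * PA) -
        (β * eF + γ * aF) * (β * eG + γ * aG)) := by
      rw [key]; linarith
    have := nonneg_of_mul_nonneg_right hprod hpos
    linarith

end Marginal

end UnionSep

end Summit.Ventures.PercRepro2
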